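import Literature.Barriers.QuantumAdvantage.PPolyOraclesThm76QuantumPost
import Literature.Computability.Cryptography.ConvergentNumeratorsFP
import Literature.Computability.Cryptography.HallgrenCandidateCheckFP
import HarnessLib

/-!
# Hallgren's classical post-processor, in polynomial time

Topic `Computability/Cryptography`; the classical half of the assembly of
`Hallgren2007_regulator_qsolvable_delim` (`HallgrenPell.lean`) for the pipeline
`familyI` (input-reading period-finding family, `PeriodFindingInputFamily.lean`) + table-bit oracle
(`PeriodFindingTableOracle.lean`) + integer walk (`InfrastructureWalkFP.lean`). Jozsa 2003, §10
(after Thm. 6): read two Fourier samples, recover the period by continued fractions, CHECK the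
candidate classically; here for every ordered pair of units of the same transform size, every
convergent numerator (`ConvergentNumeratorsFP.lean`), with the tolerant walk check
(`HallgrenCandidateCheckFP.passesI`), then the least surviving candidate `s⋆ ≈ NR` and the integer
`m = ⌊s⋆/N + 1/4⌋`, output self-delimited as `⟨bin m, ε⟩`. Everything is generic in the walk
(`IntWalkOps`/`FPSpec`) and in the walk parameters (`WalkParams`); definitions + `CodeFP` programs,
no named facts:

* `coreLen`, `cU` (the rounded character of unit `u`, = Kitaev's `cEst` on the structured read-out
  by `PPolyOraclesThm76QuantumPost.cEst_readOf`), `candOfNum` (`round(pQ/c)` in integers,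
  `candOfNum_eq_round`), `pairCands`, `cands`, `listMin` (`listMin_le`, `listMin_mem`), `result`,
  **`postPair`** (`= ⟨bin m, ε⟩`);
* the programs `cU_fp`, `pairCands_fp`, `cands_fp`, `listMin_fp`, `result_fp`, **`postPair_fp`**, and
  **`exists_postFn`**: a string function `g ∈ FP` with `g ⟨x, y⟩ = postPair x y`.

## References

* R. Jozsa, arXiv:quant-ph/0302134 (2003), §10 (proof of Thm. 6 and step (c)). [Jozsa2003]
* S. Hallgren, J. ACM 54 (2007), Art. 4, §4. [Hallgren2007]
* S. Arora, B. Barak, *Computational Complexity*, CUP 2009, §1.3. [AroraBarak2009]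
-/

noncomputable section

open scoped Classical

namespace Literature.Computability.Cryptography

namespace HallgrenPost

open _root_.Computability Complexity Complexity.CodeFP PeriodFinding OFPostCF Polynomial
  Literature.Barriers.QuantumAdvantage IntWalkOps

/-! ### Parameters -/

/-- **The walk parameters of the post-processor**: the instance read off the ORIGINAL input `x`, the
grid scale `N` (a function of `x`), the check shift `δ₀` (grid units), the walk budgets `s₀, T, M`
(functions of `x`) and the least usable block length `Lmin` (function of the core input length). [folklore] -/
structure WalkParams (δ : Type) where
  /-- the instance of the walk -/
  dOf : List Bool → δ
  /-- grid scale (a function of the input: the table code must fit the oracle's answer width) -/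
  N : List Bool → ℕ
  /-- check shift in grid units -/
  δ₀ : ℕ
  /-- start-up rounds -/
  s₀ : List Bool → ℕ
  /-- doubling levels -/
  T : List Bool → ℕ
  /-- half the final rounds -/
  M : List Bool → ℕ
  /-- least usable block length -/
  Lmin : ℕ → ℕ

variable (q : Polynomial ℕ) {δ ι : Type} (O : IntWalkOps δ ι) (W : WalkParams δ)

/-! ### The pure post-processor -/

/-- The length of the core input `⟨x, ε⟩`. [folklore] -/
def coreLen (x : List Bool) : ℕ := (boolPair x []).length

/-- `|⟨x, ε⟩| = 2|x| + 2`. [folklore] -/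
theorem coreLen_eq (x : List Bool) : coreLen x = 2 * x.length + 2 := by simp [coreLen]

/-- **The rounded character of unit `u`** read off the output string `y`. [cite: Jozsa2003, §10 (the measured c)] -/
def cU (x y : List Bool) (u : ℕ) : ℕ := cEN (ofPoly q) (coreLen x) y u (2 ^ LofC q (coreLen x) u)

/-- **The candidate from a numerator**: `round(pQ/c) = (2pQ + c) / (2c)`. [cite: Jozsa2003, §10 ("kq/c rounded")] -/
def candOfNum (Q c p : ℕ) : ℤ := (((2 * (p * Q) + c) / (2 * c) : ℕ) : ℤ)

/-- `candOfNum` is the rounding of `pQ/c` (for `c > 0`). [folklore] -/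
theorem candOfNum_eq_round {Q c : ℕ} (hc : 0 < c) (p : ℕ) : candOfNum Q c p = round ((p : ℝ) * Q / c) := by
  unfold candOfNum
  rw [← round_div_eq (p * Q) hc]
  have : ((p : ℝ) * Q / c) = ((((p * Q : ℕ) : ℚ) / (c : ℚ) : ℚ) : ℝ) := by push_cast; ring
  rw [this, Rat.round_cast]

/-- The surviving candidate test: the tolerant walk check of `HallgrenCandidateCheckFP`. [cite: Jozsa2003, §10 (c)] -/
def keep (x : List Bool) (sc : ℤ) : Bool :=
  O.passesI (W.dOf x) (W.N x) W.δ₀ (W.s₀ x) (W.T x) (2 * W.M x) sc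

/-- **The candidates of an ordered pair of units** `(u, u')`: if they share the block length `L ≥ Lmin`
and the first character is positive, every convergent numerator `p` of `c_u/c_{u'}` (fuel `2L + 1`)
gives `round(p 2^L/c_u)`, kept if it passes the check. [cite: Jozsa2003, §10] -/
def pairCands (x y : List Bool) (u u' : ℕ) : List ℤ :=
  if LofC q (coreLen x) u = LofC q (coreLen x) u' ∧ W.Lmin (coreLen x) ≤ LofC q (coreLen x) u ∧ 0 < cU q x y u then
    ((numsOf (quots (cU q x y u) (cU q x y u') (2 * LofC q (coreLen x) u + 1))).map
      (candOfNum (2 ^ LofC q (coreLen x) u) (cU q x y u))).filter (keep O W x)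
  else []

/-- **All surviving candidates.** [cite: Jozsa2003, §10] -/
def cands (x y : List Bool) : List ℤ :=
  (List.range (nU (ofPoly q) (coreLen x))).flatMap fun u =>
    (List.range (nU (ofPoly q) (coreLen x))).flatMap fun u' => pairCands q O W x y u u'

/-- The least element of a list of integers (`0` for the empty list). [folklore] -/
def listMin : List ℤ → ℤ
  | [] => 0
  | a :: l => l.foldl min a

/-- `foldl min` is below its start and its elements. [folklore] -/
theorem foldl_min_le (l : List ℤ) (a : ℤ) : l.foldl min a ≤ a ∧ ∀ b ∈ l, l.foldl min a ≤ b := by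
  induction l generalizing a with
  | nil => simp
  | cons b l ih =>
    obtain ⟨h1, h2⟩ := ih (min a b)
    refine ⟨h1.trans (min_le_left _ _), fun c hc => ?_⟩
    rw [List.mem_cons] at hc
    rcases hc with rfl | hc
    · exact h1.trans (min_le_right _ _)
    · exact h2 c hc

/-- `foldl min` is attained. [folklore] -/
theorem foldl_min_mem (l : List ℤ) (a : ℤ) : l.foldl min a = a ∨ l.foldl min a ∈ l := by
  induction l generalizing a with
  | nil => simp
  | cons b l ih =>
    rw [List.foldl_cons]
    rcases ih (min a b) with h | h
    · rw [h]
      rcases le_total a b with hab | hab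
      · left; exact min_eq_left hab
      · right; rw [min_eq_right hab]; exact List.mem_cons_self
    · right; exact List.mem_cons_of_mem _ h

/-- **`listMin` is a lower bound** of a nonempty list. [folklore] -/
theorem listMin_le {l : List ℤ} {b : ℤ} (hb : b ∈ l) : listMin l ≤ b := by
  cases l with
  | nil => cases hb
  | cons a l =>
    rw [List.mem_cons] at hb
    rcases hb with rfl | hb
    · exact (foldl_min_le l _).1
    · exact (foldl_min_le l a).2 b hb

/-- **`listMin` is attained** on a nonempty list. [folklore] -/
theorem listMin_mem {l : List ℤ} (hl : l ≠ []) : listMin l ∈ l := by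
  cases l with
  | nil => exact absurd rfl hl
  | cons a l =>
    show l.foldl min a ∈ a :: l
    rcases foldl_min_mem l a with h | h
    · rw [h]; exact List.mem_cons_self
    · exact List.mem_cons_of_mem _ h

/-- **The integer answer**: `m = ⌊s⋆/N + 1/4⌋ = (4 s⋆ + N)/(4N)` for the least candidate `s⋆`
(`0` when there is none). [cite: Jozsa2003, §3 Prop. 2 (n digits of R from an approximation)] -/
def result (x y : List Bool) : ℕ :=
  if cands q O W x y = [] then 0 else ((4 * listMin (cands q O W x y) + W.N x) / (4 * W.N x)).toNat

/-- **The post-processor on a pair** `(x, y)`: the self-delimited code `⟨bin m, ε⟩`. [cite: Hallgren2007, §4] -/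
def postPair (x y : List Bool) : List Bool := boolPair (encodeNat (result q O W x y)) []

/-! ### The programs -/

section Program

variable {eδ : δ → List Bool} {eι : ι → List Bool} (S : O.FPSpec eδ eι) (he : Function.Injective eι)
  (hd : CodeFP strE eδ W.dOf) (hN : CodeFP strE natE W.N) (hs₀ : CodeFP strE unE W.s₀) (hT : CodeFP strE unE W.T)
  (hM : CodeFP strE unE W.M) (hLmin : CodeFP unE unE W.Lmin)

/-- The core input length in unary. [folklore] -/
theorem coreLen_un : CodeFP strE unE coreLen :=
  (uadd' (umul' (const strE (2 : ℕ)) strLength) (const strE (2 : ℕ))).congr fun x => by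
    show 2 * x.length + 2 = coreLen x; rw [coreLen_eq]

/-- The core input as a string function. [folklore] -/
theorem coreInput_fp : CodeFP strE strE (fun x => boolPair x []) :=
  ((CodeFP.id strE).pair (const strE ([] : List Bool) : CodeFP strE strE fun _ => [])).recodeOut fun _ => rfl

/-- **The rounded character on codes**: `((x, y), u) ↦ c_u`. [folklore] -/
theorem cU_fp : CodeFP G1E natE (fun c : (List Bool × List Bool) × ℕ => cU q c.1.1 c.1.2 c.2) := by
  have hctx : CodeFP G1E G1E (fun c : (List Bool × List Bool) × ℕ => ((boolPair c.1.1 [], c.1.2), c.2)) :=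
    (((coreInput_fp.comp (fst _ _).fst').pair (fst _ _).snd').pair (snd _ _) :)
  exact ((cEN_fp q).comp hctx).congr fun c => rfl

/-- The capped block length on the context `((x, y), u)`. [folklore] -/
theorem L_un : CodeFP G1E unE (fun c : (List Bool × List Bool) × ℕ => LofC q (coreLen c.1.1) c.2) :=
  LofC_un q (coreLen_un.comp (fst _ _).fst') (snd _ _)

include S he hd hN hs₀ hT hM in
/-- **The check on codes**: `(x, sc) ↦ keep x sc`. [cite: Jozsa2003, §10 (c)] -/
theorem keep_fp : CodeFP (pairE strE intE) bitE (fun c : List Bool × ℤ => keep O W c.1 c.2) := by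
  have hx : CodeFP (pairE strE intE) strE (fun c => c.1) := fst _ _
  have hctx : CodeFP (pairE strE intE) (cctxE eδ)
      (fun c => (W.dOf c.1, W.N c.1, W.δ₀, W.s₀ c.1, W.T c.1, 2 * W.M c.1, c.2)) :=
    ((hd.comp hx).pair ((hN.comp hx).pair ((const _ W.δ₀).pair ((hs₀.comp hx).pair ((hT.comp hx).pair
      ((umul' (const _ (2 : ℕ)) (hM.comp hx)).pair (snd _ _)))))) :)
  exact ((codeFP_passesI S he).comp hctx).congr fun c => rfl

/-- The context `(((x, y), u), u')`. [folklore] -/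
abbrev PE : (((List Bool × List Bool) × ℕ) × ℕ) → List Bool := pairE G1E natE

include S he hd hN hs₀ hT hM hLmin in
/-- **The candidates of a pair of units on codes.** [cite: Jozsa2003, §10] -/
theorem pairCands_fp : CodeFP PE (rawE intE) (fun c : ((List Bool × List Bool) × ℕ) × ℕ =>
    pairCands q O W c.1.1.1 c.1.1.2 c.1.2 c.2) := by
  have hxy : CodeFP PE G0E (fun c => c.1.1) := (fst _ _).fst'
  have hx : CodeFP PE strE (fun c => c.1.1.1) := hxy.fst'
  have hu : CodeFP PE natE (fun c => c.1.2) := (fst _ _).snd'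
  have hu' : CodeFP PE natE (fun c => c.2) := snd _ _
  have hcu : CodeFP PE natE (fun c => cU q c.1.1.1 c.1.1.2 c.1.2) := ((cU_fp q).comp (fst _ _) :)
  have hcu' : CodeFP PE natE (fun c => cU q c.1.1.1 c.1.1.2 c.2) := ((cU_fp q).comp (hxy.pair hu') :)
  have hL : CodeFP PE unE (fun c => LofC q (coreLen c.1.1.1) c.1.2) := ((L_un q).comp (fst _ _) :)
  have hL' : CodeFP PE unE (fun c => LofC q (coreLen c.1.1.1) c.2) := ((L_un q).comp (hxy.pair hu') :)
  have hLn : CodeFP PE natE (fun c => LofC q (coreLen c.1.1.1) c.1.2) := (natOfUn.comp hL :)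
  have hQ : CodeFP PE natE (fun c => 2 ^ LofC q (coreLen c.1.1.1) c.1.2) := (natPow.comp ((const _ (2 : ℕ)).pair hL) :)
  -- the convergent numerators
  have hfuel : CodeFP PE unE (fun c => 2 * LofC q (coreLen c.1.1.1) c.1.2 + 1) :=
    uadd' (umul' (const PE (2 : ℕ)) hL) (const PE (1 : ℕ))
  have hnums : CodeFP PE (rawE natE) (fun c => numsOf (quots (cU q c.1.1.1 c.1.1.2 c.1.2) (cU q c.1.1.1 c.1.1.2 c.2)
      (2 * LofC q (coreLen c.1.1.1) c.1.2 + 1))) := (codeFP_convNums.comp (hcu.pair (hcu'.pair hfuel)) :)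
  -- the candidates and the filter
  have hcand : CodeFP (pairE PE natE) intE (fun t : (((List Bool × List Bool) × ℕ) × ℕ) × ℕ =>
      candOfNum (2 ^ LofC q (coreLen t.1.1.1.1) t.1.1.2) (cU q t.1.1.1.1 t.1.1.1.2 t.1.1.2) t.2) := by
    have hQ' : CodeFP (pairE PE natE) natE (fun t => 2 ^ LofC q (coreLen t.1.1.1.1) t.1.1.2) := (hQ.comp (fst PE natE) :)
    have hc' : CodeFP (pairE PE natE) natE (fun t => cU q t.1.1.1.1 t.1.1.1.2 t.1.1.2) := (hcu.comp (fst PE natE) :)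
    have hp : CodeFP (pairE PE natE) natE (fun t => t.2) := snd _ _
    exact ((intOfNat.comp (natDiv.comp ((natAdd.comp ((natMul.comp ((const _ (2 : ℕ)).pair (natMul.comp (hp.pair hQ')))).pair
      hc')).pair (natMul.comp ((const _ (2 : ℕ)).pair hc'))))).congr fun t => rfl)
  have hmapped : CodeFP PE (rawE intE) (fun c => (numsOf (quots (cU q c.1.1.1 c.1.1.2 c.1.2) (cU q c.1.1.1 c.1.1.2 c.2)
      (2 * LofC q (coreLen c.1.1.1) c.1.2 + 1))).map (candOfNum (2 ^ LofC q (coreLen c.1.1.1) c.1.2) (cU q c.1.1.1 c.1.1.2 c.1.2))) :=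
    ((map hcand).comp ((CodeFP.id PE).pair hnums)).congr fun c => rfl
  have hkeep : CodeFP (pairE PE intE) bitE (fun t : (((List Bool × List Bool) × ℕ) × ℕ) × ℤ => keep O W t.1.1.1.1 t.2) :=
    ((keep_fp O W S he hd hN hs₀ hT hM).comp ((hx.comp (fst PE intE)).pair (snd _ _)) :)
  have hfilt : CodeFP PE (rawE intE) (fun c => ((numsOf (quots (cU q c.1.1.1 c.1.1.2 c.1.2) (cU q c.1.1.1 c.1.1.2 c.2)
      (2 * LofC q (coreLen c.1.1.1) c.1.2 + 1))).map (candOfNum (2 ^ LofC q (coreLen c.1.1.1) c.1.2)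
        (cU q c.1.1.1 c.1.1.2 c.1.2))).filter (keep O W c.1.1.1)) :=
    ((filter hkeep).comp ((CodeFP.id PE).pair hmapped)).congr fun c => rfl
  -- the guard
  have hg : CodeFP PE bitE (fun c => decide (LofC q (coreLen c.1.1.1) c.1.2 = LofC q (coreLen c.1.1.1) c.2) &&
      (decide (W.Lmin (coreLen c.1.1.1) ≤ LofC q (coreLen c.1.1.1) c.1.2) && decide (0 < cU q c.1.1.1 c.1.1.2 c.1.2))) :=
    ((natEq.comp (hLn.pair (natOfUn.comp hL'))) :).and
      (((natLe.comp ((natOfUn.comp (hLmin.comp (coreLen_un.comp hx))).pair hLn)) :).and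
        ((natLt.comp ((const _ (0 : ℕ)).pair hcu)) :))
  refine ((hg.ite hfilt (const _ ([] : List ℤ))).congr fun c => ?_)
  unfold pairCands
  by_cases h1 : LofC q (coreLen c.1.1.1) c.1.2 = LofC q (coreLen c.1.1.1) c.2 <;>
    by_cases h2 : W.Lmin (coreLen c.1.1.1) ≤ LofC q (coreLen c.1.1.1) c.1.2 <;>
    by_cases h3 : 0 < cU q c.1.1.1 c.1.1.2 c.1.2 <;> simp [h1, h2, h3]

include S he hd hN hs₀ hT hM hLmin in
/-- **All candidates on codes.** [cite: Jozsa2003, §10] -/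
theorem cands_fp : CodeFP G0E (rawE intE) (fun c : List Bool × List Bool => cands q O W c.1 c.2) := by
  have hn0 : CodeFP G0E unE (fun c => nU (ofPoly q) (coreLen c.1)) := ((nU_un q).comp (coreLen_un.comp (fst _ _)) :)
  have hn1 : CodeFP G1E unE (fun c : (List Bool × List Bool) × ℕ => nU (ofPoly q) (coreLen c.1.1)) := (hn0.comp (fst _ _) :)
  have hinner : CodeFP G1E (rawE intE) (fun c : (List Bool × List Bool) × ℕ =>
      (List.range (nU (ofPoly q) (coreLen c.1.1))).flatMap fun u' => pairCands q O W c.1.1 c.1.2 c.2 u') :=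
    flatMapRange hn1 (pairCands_fp q O W S he hd hN hs₀ hT hM hLmin)
  exact (flatMapRange hn0 hinner).congr fun c => rfl

/-- **The least element on codes.** [folklore] -/
theorem listMin_fp : CodeFP (rawE intE) intE listMin := by
  -- `foldl min` with the head as start, the accumulator being an element of the input
  have hstep : CodeFP (pairE (rawE intE) (pairE intE intE)) intE (fun t => min t.2.2 t.2.1) := by
    have ha : CodeFP (pairE (rawE intE) (pairE intE intE)) intE (fun t => t.2.1) := (snd _ _).fst'
    have hb : CodeFP (pairE (rawE intE) (pairE intE intE)) intE (fun t => t.2.2) := (snd _ _).snd'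
    refine (((intLe.comp (hb.pair ha)) :).ite hb ha).congr fun t => ?_
    by_cases h : t.2.2 ≤ t.2.1 <;> simp [h, min_def]
  have hinit : CodeFP (rawE intE) intE (fun l => l.headD 0) :=
    ((rawHeadOr intE).comp ((const _ (0 : ℤ)).pair (CodeFP.id _))).congr fun l => rfl
  have h := foldl (σ := List ℤ) (α := ℤ) (β := ℤ) (eσ := rawE intE) (eα := intE) (eβ := intE)
    (step := fun _ a b => min b a) (init := fun l => l.headD 0) hstep hinit (X + 4)
    (fun l l₁ l₂ => by
      simp only [eval_add, eval_X, eval_ofNat]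
      have hmem : l₁.foldl (fun b a => min b a) (l.headD 0) = l.headD 0 ∨ l₁.foldl (fun b a => min b a) (l.headD 0) ∈ l₁ := by
        have := foldl_min_mem l₁ (l.headD 0)
        simpa using this
      have hbound : ∀ z : ℤ, (z = l.headD 0 ∨ z ∈ l₁) → (intE z).length ≤ (pairE (rawE intE) (rawE intE) (l, l₁ ++ l₂)).length := by
        rintro z (rfl | hz)
        · simp only [pairE_apply, length_boolPair]
          cases l with
          | nil =>
            have h0 : (intE (0 : ℤ)).length ≤ 2 := by decide
            simp only [List.headD_nil]
            omega
          | cons a l =>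
            have := length_item_le_length_rawE intE (List.mem_cons_self (a := a) (l := l))
            simp only [List.headD_cons]
            omega
        · simp only [pairE_apply, length_boolPair]
          have := length_item_le_length_rawE intE (List.mem_append_left l₂ hz)
          omega
      have := hbound _ hmem
      omega)
  refine ((h.comp ((CodeFP.id _).pair (rawTail intE))).congr fun l => ?_)
  cases l with
  | nil => rfl
  | cons a l =>
    show l.foldl (fun b a => min b a) a = l.foldl min a
    rfl

include S he hd hN hs₀ hT hM hLmin in
/-- **The integer answer on codes.** [folklore] -/
theorem result_fp : CodeFP G0E natE (fun c : List Bool × List Bool => result q O W c.1 c.2) := by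
  have hc := cands_fp q O W S he hd hN hs₀ hT hM hLmin
  have hnil : CodeFP G0E bitE (fun c => decide (cands q O W c.1 c.2 = [])) :=
    ((natEq.comp (((natLength intE).comp hc).pair (const _ (0 : ℕ)))).congr fun c => by
      simp [List.length_eq_zero_iff])
  have hmin : CodeFP G0E intE (fun c => listMin (cands q O W c.1 c.2)) := (listMin_fp.comp hc :)
  have hNz : CodeFP G0E intE (fun c : List Bool × List Bool => (W.N c.1 : ℤ)) := (intOfNat.comp (hN.comp (fst _ _)) :)
  have hval : CodeFP G0E natE (fun c => ((4 * listMin (cands q O W c.1 c.2) + W.N c.1) / (4 * W.N c.1)).toNat) :=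
    (intToNat.comp (intEDiv.comp ((intAdd.comp ((intMul.comp ((const _ (4 : ℤ)).pair hmin)).pair hNz)).pair
      (intMul.comp ((const _ (4 : ℤ)).pair hNz)))) :)
  refine ((hnil.ite (const _ (0 : ℕ)) hval).congr fun c => ?_)
  unfold result
  by_cases h : cands q O W c.1 c.2 = [] <;> simp [h]

include S he hd hN hs₀ hT hM hLmin in
/-- **The post-processor on codes.** [cite: Hallgren2007, §4] [cite: AroraBarak2009, §1.3] -/
theorem postPair_fp : CodeFP G0E strE (fun c : List Bool × List Bool => postPair q O W c.1 c.2) :=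
  ((result_fp q O W S he hd hN hs₀ hT hM hLmin).pair (const G0E ([] : List Bool) : CodeFP G0E strE fun _ => [])).recodeOut fun _ => rfl

include S he hd hN hs₀ hT hM hLmin in
/-- **The post-processor as a polynomial-time string function**: some `g ∈ FP` with
`g ⟨x, y⟩ = postPair x y` for all `x, y`. [cite: AroraBarak2009, §1.3] -/
theorem exists_postFn : ∃ g : List Bool → List Bool, g ∈ FP ∧ ∀ x y, g (boolPair x y) = postPair q O W x y := by
  obtain ⟨g, hg, hgs⟩ := postPair_fp q O W S he hd hN hs₀ hT hM hLmin
  exact ⟨g, hg, fun x y => hgs (x, y)⟩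

end Program

end HallgrenPost

end Literature.Computability.Cryptography

end
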